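import Mathlib
import Literature.NumberTheory.Sieve.LinearEquationsInPrimesSieveTau
import Summits.NavierStokesRegularity.NavierStokesRegularity.Theorems.TaoLadderRungThreeGappedFrontRobustStepTransfer
import HarnessLib

/-!
# `TrappingWindowRungThree.TailEnvelopes` (item stmt-NavierStokesRegularity-21748, crux K2) — the
  window phantom budget

Helper for the analytic tail envelopes K2 of route `TrappingWindowRungThree` (rung TL-M3 of the Tao
ladder; MODEL lattice ODEs only — Tao 2016, §4 (4.10) in the cell vocabulary `TaoCascade.PseudoFlowOn`):
`window_phantom_lt` — on a window shell whose amplitude stays under the sup bound `M_k`, whose slack is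
`≤ η w` with the slack condition WC `2w + (c 4^k + 1) M_k² ≤ W_k`, and with `η c 4^k ≤ 1/5`, the phantom
energy stays STRICTLY below `η W_k`: `F_{i,k}(s) < ½ S_{i,k}(s)² + η W_k` on `[0, σ]` (defect Grönwall
`pseudoFlowOn_energy_le_exp`, then (4.10) once more; `exp x ≤ 1 + 2x` is the tree's
`Literature.NumberTheory.Sieve.exp_le_one_add_two_mul`).

HONEST FRAMING: bookkeeping about Tao-type MODEL lattice pseudo-flows; nothing here is a statement about
the Navier–Stokes equations; NS regularity is NOT proved by anything in this file.
-/

noncomputable section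

-- the sub-problem namespace repeats the summit name by design (D-0017)
set_option linter.dupNamespace false

namespace Summit.NavierStokesRegularity.NavierStokesRegularity.Theorems

open Set MeasureTheory intervalIntegral Literature.Analysis.FluidPDE
  Literature.Analysis.FluidPDE.TaoCascade GappedFrontRobust

namespace TailEnvelopes

variable {m : ℕ}

/-! ### The window phantom budget -/

variable {σ η : ℝ} {α : Fin m → Fin m → Fin m → ℤ × ℤ × ℤ → ℝ}
  {S₀ F₀ B₀ : Fin m → ℤ → ℝ} {S F : Fin m → ℤ → ℝ → ℝ}

/-- **Window phantom budget.** Along an `(η, η)`-pseudo-flow at scale ratio `2` on `[0, σ]`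
(`0 < σ ≤ c`, `η > 0`), consider a shell `k` whose amplitude stays `≤ M_k` on `[0, σ]` (`M_k > 0`),
whose slack obeys `0 ≤ B₀_{i,k} ≤ η · w` and whose allowance satisfies the slack condition WC
`2 w + (c 4^k + 1) M_k² ≤ W_k`. If `η c 4^k ≤ 1/5`, then the phantom energy stays STRICTLY below the
budget: `F_{i,k}(s) < ½ S_{i,k}(s)² + η W_k` on `[0, σ]` (defect Grönwall (4.10):
`F ≤ (½M_k² + B₀) e^{η 4^k s} ≤ (7/5)(½M_k² + B₀)`, then (4.10) once more with `∫₀ˢ F ≤ c · sup F`).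
[cite: Tao2016AveragedNS, §4 Lemma 4.1 (4.10)] -/
theorem window_phantom_lt (h : PseudoFlowOn σ 1 α η η S₀ F₀ B₀ S F) (hσ : 0 < σ) {c : ℝ}
    (hσc : σ ≤ c) (hη : 0 < η) (i : Fin m) (k : ℤ) {Mk Wk w : ℝ} (hMk : 0 < Mk)
    (hWC : 2 * w + (c * (2 : ℝ) ^ ((2 : ℝ) * (k : ℝ)) + 1) * Mk ^ 2 ≤ Wk)
    (hB₀ : 0 ≤ B₀ i k ∧ B₀ i k ≤ η * w) (hwin : ∀ u ∈ Icc 0 σ, |S i k u| ≤ Mk)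
    (hsmall : η * c * (2 : ℝ) ^ ((2 : ℝ) * (k : ℝ)) ≤ 1 / 5) :
    ∀ s ∈ Icc 0 σ, F i k s < (1 / 2) * S i k s ^ 2 + η * Wk := by
  intro s hs
  have h2 : (1 + 1 : ℝ) = 2 := one_add_one_eq_two
  set q : ℝ := (2 : ℝ) ^ ((2 : ℝ) * (k : ℝ)) with hq
  have hq0 : 0 < q := Real.rpow_pos_of_pos two_pos _
  have hc0 : 0 < c := hσ.trans_le hσc
  -- the kinetic part is at most ½ M_k² on [0, σ]
  have hA : ∀ u ∈ Icc 0 σ, (1 / 2) * S i k u ^ 2 ≤ (1 / 2) * Mk ^ 2 := by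
    intro u hu
    have h1 := hwin u hu
    have : S i k u ^ 2 ≤ Mk ^ 2 := by
      rw [← sq_abs]; exact pow_le_pow_left₀ (abs_nonneg _) h1 2
    linarith
  -- defect Grönwall
  have hexp := pseudoFlowOn_energy_le_exp h (by norm_num) hη.le i k (s := σ) ⟨hσ.le, le_rfl⟩ hA
  -- the exponent is at most 1/5 on [0, σ]
  have hFmax : ∀ u ∈ Icc 0 σ, F i k u ≤ 7 / 5 * ((1 / 2) * Mk ^ 2 + B₀ i k) := by
    intro u hu
    have h1 := hexp u hu
    rw [h2] at h1
    have hx0 : 0 ≤ η * q * u := by have := hu.1; positivity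
    have hx1 : η * q * u ≤ 1 / 5 := by
      have huc : u ≤ c := hu.2.trans hσc
      calc η * q * u ≤ η * q * c := mul_le_mul_of_nonneg_left huc (by positivity)
        _ = η * c * q := by ring
        _ ≤ 1 / 5 := hsmall
    have hE : Real.exp (η * q * u) ≤ 7 / 5 := by
      have := Literature.NumberTheory.Sieve.exp_le_one_add_two_mul hx0 (by linarith)
      linarith
    have hpos : 0 ≤ (1 / 2) * Mk ^ 2 + B₀ i k := by have := hB₀.1; positivity
    calc F i k u ≤ ((1 / 2) * Mk ^ 2 + B₀ i k) * Real.exp (η * q * u) := h1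
      _ ≤ ((1 / 2) * Mk ^ 2 + B₀ i k) * (7 / 5) := mul_le_mul_of_nonneg_left hE hpos
      _ = 7 / 5 * ((1 / 2) * Mk ^ 2 + B₀ i k) := by ring
  -- the time integral of the energy
  have hint : ∫ u in (0 : ℝ)..s, F i k u ≤ c * (7 / 5 * ((1 / 2) * Mk ^ 2 + B₀ i k)) := by
    have hle : ∀ u ∈ Set.uIoc (0 : ℝ) s, ‖F i k u‖ ≤ 7 / 5 * ((1 / 2) * Mk ^ 2 + B₀ i k) := by
      intro u hu
      rw [uIoc_of_le hs.1] at hu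
      have hu' : u ∈ Icc 0 σ := ⟨hu.1.le, hu.2.trans hs.2⟩
      rw [Real.norm_eq_abs, abs_of_nonneg (h.nonneg_F i k u hu')]
      exact hFmax u hu'
    have h1 := intervalIntegral.norm_integral_le_of_norm_le_const hle
    rw [Real.norm_eq_abs, sub_zero, abs_of_nonneg hs.1] at h1
    have hpos : 0 ≤ 7 / 5 * ((1 / 2) * Mk ^ 2 + B₀ i k) := by have := hB₀.1; positivity
    have h3 : 7 / 5 * ((1 / 2) * Mk ^ 2 + B₀ i k) * s ≤ 7 / 5 * ((1 / 2) * Mk ^ 2 + B₀ i k) * c :=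
      mul_le_mul_of_nonneg_left (hs.2.trans hσc) hpos
    linarith [le_abs_self (∫ u in (0 : ℝ)..s, F i k u)]
  -- (4.10) at time s
  have hdef := h.defect_upper i k s hs
  rw [h2, ← hq] at hdef
  -- bookkeeping: x = η c 4^k ≤ 1/5, c 4^k M² ≤ W - 2w - M², B₀ ≤ η w
  have hcq : c * q * Mk ^ 2 ≤ Wk - 2 * w - Mk ^ 2 := by nlinarith
  have hterm : η * q * ∫ u in (0 : ℝ)..s, F i k u ≤ η * q * (c * (7 / 5 * ((1 / 2) * Mk ^ 2 + B₀ i k))) :=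
    mul_le_mul_of_nonneg_left hint (by positivity)
  have hB := hB₀.2
  have hB0 := hB₀.1
  -- η q c (7/5)(½M² + B₀) = (7/10) η (c q M²) + (7/5)(η c q) B₀ ≤ (7/10) η (W - 2w - M²) + (7/25) B₀
  have e1 : η * q * (c * (7 / 5 * ((1 / 2) * Mk ^ 2 + B₀ i k))) =
      7 / 10 * η * (c * q * Mk ^ 2) + 7 / 5 * (η * c * q) * B₀ i k := by ring
  have h3 : 7 / 10 * η * (c * q * Mk ^ 2) ≤ 7 / 10 * η * (Wk - 2 * w - Mk ^ 2) :=
    mul_le_mul_of_nonneg_left hcq (by positivity)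
  have h4 : 7 / 5 * (η * c * q) * B₀ i k ≤ 7 / 5 * (1 / 5) * B₀ i k :=
    mul_le_mul_of_nonneg_right (mul_le_mul_of_nonneg_left hsmall (by norm_num)) hB0
  have hw0 : 0 ≤ w := by
    by_contra hneg
    push Not at hneg
    have : η * w < 0 := mul_neg_of_pos_of_neg hη hneg
    linarith
  have hM2 : 0 < η * Mk ^ 2 := by positivity
  have hηw : 0 ≤ η * w := by positivity
  have hWk : 0 ≤ Wk := by
    have : 0 ≤ (c * q + 1) * Mk ^ 2 := by positivity
    linarith [hWC, hw0]
  have hηW : 0 ≤ η * Wk := by positivity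
  linarith [hdef, hterm, e1, h3, h4, hB, hM2, hηw, hηW]


end TailEnvelopes

end Summit.NavierStokesRegularity.NavierStokesRegularity.Theorems

end
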